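import Literature.Probability.FitznerVanDerHofstad2017.Stage1Frame
import Literature.Probability.FitznerVanDerHofstad2017.PosExprEval

/-!
# Literature.Probability.FitznerVanDerHofstad2017.Stage1Eval — the typed stage 1 at rational data

CITATION HEADER (PLACEMENT v2). Part of the certified REPRODUCTION of R. Fitzner, R. van der Hofstad, *Mean-field
behavior for nearest-neighbor percolation in d > 10*, EJP 22 (2017) no. 43 [FvdH17] (notebooks `Percolation.nb`,
`SRW.nb`, `General.nb`) and *Generalized approach to the non-backtracking lace expansion*, PTRF 169 (2017) 1041–1119
[NoBLE17]; build `lace`, seat lean2 (gen 10), GAPS G8 layer L1′ STEP 2 (α): the KERNEL-EVALUABLE form of the typed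
stage 1 `Stage1Frame.Data.inp` (cell 44, tail-free variant `T″₀`).  ADDITIVE companion of `Stage1Frame.lean` and
`PosExprEval.lean` (nothing there is changed); no numeral of the notebooks, no table, no verdict; nothing here is a cited
fact.

What this module is.  `Stage1Frame.Data` carries REAL tables and the REAL valuations `Data.val0` / `Data.val`
(`noncomputable`: `PX.eval` over `ℝ`).  The certified SRW tables of the two engines and the iterated state are finite
decimals, i.e. RATIONAL.  This file gives

* `TabsQ`, `StateQ`, `DataQ` — rational stage-1 tables, a rational state, and the rational static data of the stage-1
  valuation (tables + the six initial-point cells `boundF3[j,i]`), with their casts `TabsQ.cast : Tabs`,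
  `StateQ.cast : NoGoFrame.State`;
* `DataQ.val0`, `DataQ.ev0`, `DataQ.g13`, `DataQ.ob1`, `DataQ.val`, `DataQ.ev`, `K1Q … K5Q`, `DataQ.piAlphaLower0`,
  …, `DataQ.muMin`, `DataQ.inpR` — the SAME definitions as `Stage1Frame.Data.val0 … Data.inp`, verbatim over `ℚ`
  (cells evaluated by `PX.evalQ`, the recursor form that `decide +kernel` reduces by `ι`-reduction);
* the model relation `Data.RatModel D E` (the frame's tables are the casts of `E`'s, its initial cells the casts of
  `E.ic`) and, under it, the CAST LEMMAS `Data.ev_ratCast : D.ev s y.cast e = ↑(E.ev D.P s y e)`,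
  `Data.muMin_ratCast`, …, `Data.inp_ratCast : D.inp y.cast s = E.inpR D.P y s`, and
  `Data.inp_dom_of_ratModel` / `Data.dom_inp_of_ratModel` / `Data.uAt_of_ratModel`: an `Inputs.Dom` comparison of
  the typed cell-44 record with a numeral record, and the validity conditions `Data.UAt`, at rational data ARE
  finitely many decidable inequalities between rationals — the shape in which the kernel checks them
  (`norm_cast; decide +kernel` per field).

What it is for (GAPS G8, L1′ → L0).  With `E` := the certified rational tables of a run and `y` := its certified state,
`Data.inp_ratCast` turns "the numerals of `MeanFieldD11Inputs` dominate the typed notebook formulas at the certified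
tables" into kernel arithmetic.  Which TABLES make that statement the published one (upper / lower enclosures, the
table-direction order facts `PX.eval_mono_tab`), and which FORMULA VARIANT the numerals belong to, is the instantiating
certificate's business and is recorded there, not here.  Scope of this file: cell 44 without the `N ≥ 4` tails
(`Stage1Tails.inpFull` adds them; its rational mirror is STEP 2 (β)).

[folklore]
-/

namespace Literature.Probability.FitznerVanDerHofstad2017
namespace Stage1Cells

open NoGoFrame BetaMap PX

/-! ## Rational tables -/

/-- RATIONAL stage-1 tables (`Ivalue`, `K`, `nrSAW`, `nrBAW` over the classes `V`), the exact counterpart of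
`Stage1Cells.Tabs`. [folklore] -/
structure TabsQ where
  /-- `Ivalue[n,l,v]` -/
  I : ℕ → ℕ → V → ℚ
  /-- `K[n,l,v]` -/
  K : ℕ → ℕ → V → ℚ
  /-- `nrSAW[j,d,v]` -/
  saw : ℕ → V → ℚ
  /-- `nrBAW[j,d,v]` -/
  baw : ℕ → V → ℚ

namespace TabsQ

variable (t : TabsQ)

/-- the real tables a rational table record denotes. [folklore] -/
def cast : Tabs where
  I n l v := t.I n l v
  K n l v := t.K n l v
  saw j v := t.saw j v
  baw j v := t.baw j v

/-- the rational table valuation of `TKey` (verbatim `Tabs.val` over `ℚ`). [folklore] -/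
def val (d : ℕ) : TKey → ℚ
  | .I n l v => t.I n l v
  | .K n l v => t.K n l v
  | .saw j v => t.saw j v
  | .baw j v => t.baw j v
  | .sawIk6 => t.saw 6 .v2 - 36 * ((d : ℚ) - 2) ^ 2
  | .sawIk4 => t.saw 4 .v2 - 2 * ((d : ℚ) - 2)
  | .sawTwoi6 => t.saw 6 .v01 - 36 * ((d : ℚ) - 2) ^ 2

/-- the real valuation of the cast tables is the cast of the rational valuation. [folklore] -/
theorem val_cast (d : ℕ) : ∀ k, t.cast.val d k = ((t.val d k : ℚ) : ℝ)
  | .I _ _ _ => rfl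
  | .K _ _ _ => rfl
  | .saw _ _ => rfl
  | .baw _ _ => rfl
  | .sawIk6 => by simp only [Tabs.val, val, cast]; push_cast; ring
  | .sawIk4 => by simp only [Tabs.val, val, cast]; push_cast; ring
  | .sawTwoi6 => by simp only [Tabs.val, val, cast]; push_cast; ring

/-- `val_cast` as an equation of valuations. [folklore] -/
theorem val_cast' (d : ℕ) : t.cast.val d = fun k => ((t.val d k : ℚ) : ℝ) := funext (t.val_cast d)

/-- well-formedness of the cast tables from rational sign facts. [folklore] -/
theorem cast_wf {d : ℕ} (hI : ∀ n l v, 0 ≤ t.I n l v) (hK : ∀ n l v, 0 ≤ t.K n l v) (hsaw : ∀ j v, 0 ≤ t.saw j v)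
    (hbaw : ∀ j v, 0 ≤ t.baw j v) (h6 : 36 * ((d : ℚ) - 2) ^ 2 ≤ t.saw 6 .v2) (h4 : 2 * ((d : ℚ) - 2) ≤ t.saw 4 .v2)
    (h6' : 36 * ((d : ℚ) - 2) ^ 2 ≤ t.saw 6 .v01) : t.cast.WF d where
  I n l v := by simp only [cast]; exact_mod_cast hI n l v
  K n l v := by simp only [cast]; exact_mod_cast hK n l v
  saw j v := by simp only [cast]; exact_mod_cast hsaw j v
  baw j v := by simp only [cast]; exact_mod_cast hbaw j v
  sawIk6 := by simp only [cast]; exact_mod_cast h6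
  sawIk4 := by simp only [cast]; exact_mod_cast h4
  sawTwoi6 := by simp only [cast]; exact_mod_cast h6'

end TabsQ

/-! ## Rational state and rational static data -/

/-- a RATIONAL state `(Γ₁, m, Γ₂, c)`, the exact counterpart of `NoGoFrame.State`. [folklore] -/
structure StateQ where
  /-- `Γ₁` -/
  Gamma1 : ℚ
  /-- `m` -/
  m : ℚ
  /-- `Γ₂` -/
  Gamma2 : ℚ
  /-- the weights `c_j` -/
  c : Fin 6 → ℚ

/-- the real state a rational state denotes. [folklore] -/
def StateQ.cast (y : StateQ) : State := ⟨y.Gamma1, y.m, y.Gamma2, fun j => y.c j⟩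

/-- `Γ₁` of the cast. [folklore] -/
@[simp] theorem StateQ.cast_Gamma1 (y : StateQ) : y.cast.Gamma1 = ((y.Gamma1 : ℚ) : ℝ) := rfl
/-- `m` of the cast. [folklore] -/
@[simp] theorem StateQ.cast_m (y : StateQ) : y.cast.m = ((y.m : ℚ) : ℝ) := rfl
/-- `Γ₂` of the cast. [folklore] -/
@[simp] theorem StateQ.cast_Gamma2 (y : StateQ) : y.cast.Gamma2 = ((y.Gamma2 : ℚ) : ℝ) := rfl
/-- `c_j` of the cast. [folklore] -/
@[simp] theorem StateQ.cast_c (y : StateQ) (j : Fin 6) : y.cast.c j = ((y.c j : ℚ) : ℝ) := rfl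

/-- The RATIONAL static data of the stage-1 valuation: rational tables and the six initial-point cells `boundF3[j,i]`
(in `Stage1Frame.Data` these are `Data.initCell`, computed from the `f₃` tables; here they are data, and the model
relation `Data.RatModel` records the identification). [folklore] -/
structure DataQ where
  /-- stage-1 tables -/
  tabs : TabsQ
  /-- `boundF3[j,i]`, `j = 1..6` -/
  ic : Fin 6 → ℚ

/-- the dimension of `P` as a rational. [folklore] -/
def dQ (P : Params) : ℚ := (P.d : ℚ)

/-- `z[s]` over `ℚ` (verbatim `Data.zAt`). [folklore] -/
def zAtQ (P : Params) : Pt → StateQ → ℚ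
  | .i, _ => 1 / (2 * dQ P - 1)
  | .o, y => y.Gamma1 / (2 * dQ P - 1)

/-- `VarGamma2[s]` over `ℚ` (verbatim `Data.VAt`). [folklore] -/
def VAtQ (P : Params) : Pt → StateQ → ℚ
  | .i, _ => (2 * dQ P - 2) / (2 * dQ P - 1)
  | .o, y => y.Gamma2 * ((2 * dQ P - 2) / (2 * dQ P - 1))

namespace DataQ

variable (E : DataQ) (P : Params)

/-- the weighted constants over `ℚ` (verbatim `Data.cAt`). [folklore] -/
def cAt : Pt → StateQ → Fin 6 → ℚ
  | .i, _ => E.ic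
  | .o, y => y.c

/-- the BASIC rational valuation (verbatim `Data.val0`). [folklore] -/
def val0 (s : Pt) (y : StateQ) : Atom → ℚ
  | .z => zAtQ P s y
  | .V => VAtQ P s y
  | .cw j => E.cAt s y j
  | .Vo => VAtQ P .o y
  | .G13at _ => 0
  | .mubOverMu => 0
  | .mubOverMuI => 0
  | .hdInv => 0

/-- evaluation under the basic rational valuation (verbatim `Data.ev0`, by `PX.evalQ`). [folklore] -/
noncomputable def ev0 (s : Pt) (y : StateQ) (e : T) : ℚ := evalQ (E.val0 P s y) (E.tabs.val P.d) e

/-- `Bound[G,{1},3,s]` over `ℚ` (verbatim `Data.g13`). [folklore] -/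
noncomputable def g13 (s : Pt) (y : StateQ) : ℚ := E.ev0 P s y (G13 P)

/-- `Bound[OpenBubble,1,s]` over `ℚ` (verbatim `Data.ob1`). [folklore] -/
noncomputable def ob1 (s : Pt) (y : StateQ) : ℚ := E.ev0 P s y (openBubble P 1 0)

/-- the FULL rational valuation (verbatim `Data.val`). [folklore] -/
noncomputable def val (s : Pt) (y : StateQ) : Atom → ℚ
  | .G13at t => E.g13 P t y
  | .mubOverMu => 1 / (1 - E.g13 P s y)
  | .mubOverMuI => 1 / (1 - E.g13 P .i y)
  | .hdInv => 1 / (1 - E.ob1 P s y)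
  | a => E.val0 P s y a

/-- evaluation of a cell at rational data (verbatim `Data.ev`, by `PX.evalQ`). [folklore] -/
noncomputable def ev (s : Pt) (y : StateQ) (e : T) : ℚ := evalQ (E.val P s y) (E.tabs.val P.d) e

end DataQ

/-! ## Cells 36–37, 44 over `ℚ` -/

/-- `z[i] = 1/(2d−1)` over `ℚ` (verbatim `Data.zIr`). [folklore] -/
def zIrQ (P : Params) : ℚ := 1 / (2 * dQ P - 1)

/-- cell 36 constant `K₁` over `ℚ` (verbatim `Data.K1`). [cite: FitznerVanDerHofstad2017, notebook Percolation.nb cell 36] -/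
def K1Q (P : Params) : ℚ := (2 * dQ P - 1) * (2 * dQ P - 2) * zIrQ P ^ 4 * (1 - zIrQ P ^ 3) ^ (2 * P.d - 3)
/-- cell 36 constant `K₂` over `ℚ` (verbatim `Data.K2`). [cite: FitznerVanDerHofstad2017, notebook Percolation.nb cell 36] -/
def K2Q (P : Params) : ℚ := 16 * (dQ P - 1) * (dQ P - 2) * (2 * dQ P - 3) * zIrQ P ^ 6 * (1 - zIrQ P ^ 3) ^ (2 * P.d - 2)
  * (1 - zIrQ P ^ 5) ^ (16 * (P.d - 1) * (P.d - 2) - 1)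
/-- cell 36 constant `K₃` over `ℚ` (verbatim `Data.K3`). [cite: FitznerVanDerHofstad2017, notebook Percolation.nb cell 36] -/
def K3Q (P : Params) : ℚ := 4 * 16 * dQ P * (dQ P - 1) * (dQ P - 2) * zIrQ P ^ 6 * (1 - zIrQ P) * (1 - zIrQ P ^ 3) ^ (2 * P.d - 2)
  * (1 - zIrQ P ^ 5) ^ (16 * (P.d - 1) * (P.d - 2))
/-- cell 36 constant `K₄` over `ℚ` (verbatim `Data.K4`). [cite: FitznerVanDerHofstad2017, notebook Percolation.nb cell 36] -/
def K4Q (P : Params) : ℚ := (2 * dQ P - 2) ^ 2 * (2 * dQ P - 3) * zIrQ P ^ 7 * (1 - zIrQ P ^ 3) ^ (2 * P.d - 3)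
/-- cell 36 constant `K₅` over `ℚ` (verbatim `Data.K5`). [cite: FitznerVanDerHofstad2017, notebook Percolation.nb cell 36] -/
def K5Q (P : Params) : ℚ := (2 * dQ P - 2) ^ 3 * (2 * dQ P - 3) * zIrQ P ^ 8 * (1 - zIrQ P ^ 3) ^ (2 * P.d - 3)

namespace DataQ

variable (E : DataQ) (P : Params)

/-- cell 36 `Bound[Pi,alpha,lower,0,s]` over `ℚ` (verbatim `Data.piAlphaLower0`). [cite: FitznerVanDerHofstad2017, notebook Percolation.nb cell 36] -/
noncomputable def piAlphaLower0 (s : Pt) (y : StateQ) : ℚ :=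
  K1Q P - E.ev P s y (piAlphaLowSub P) + K2Q P * (1 - E.ev P s y (piAlphaLowBr P))

/-- cell 36 `Bound[Psi,lower,0,s]` over `ℚ` (verbatim `Data.psiLower0`). [cite: FitznerVanDerHofstad2017, notebook Percolation.nb cell 36] -/
noncomputable def psiLower0 (s : Pt) (y : StateQ) : ℚ :=
  K1Q P - E.ev P s y (piAlphaLowSub P) + (2 * dQ P - 2) ^ 2 * zIrQ P ^ 4 * (1 - E.ev P s y (psiLowBr1 P))
    - 2 * dQ P * (2 * dQ P - 2) * zIrQ P ^ 4 * E.ev P s y (vartheta P) + K3Q P * (1 - E.ev P s y (psiLowBr2 P))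

/-- cell 36 `Bound[Pi,1,Lower,s]` over `ℚ` (verbatim `Data.pi1Lower`). [cite: FitznerVanDerHofstad2017, notebook Percolation.nb cell 36] -/
noncomputable def pi1Lower (s : Pt) (y : StateQ) : ℚ :=
  (2 * dQ P - 1) * (2 * dQ P - 2) * zIrQ P ^ 5 * (1 - E.ev P s y (pi1Br0 P))
    - (2 * dQ P - 2) * zIrQ P ^ 5 * E.ev P s y (pi1T2 P)
    + K4Q P * ((1 - E.ev P s y (pi1Br3a P)) * (1 - E.ev P s y (pi1Br3b P)))
    + K4Q P * ((1 - E.ev P s y (pi1Br4a P)) * (1 - E.ev P s y (pi1Br4b P)))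
    + K5Q P * ((1 - E.ev P s y (pi1Br5a P)) * (1 - E.ev P s y (pi1Br5b P)))

/-- cell 37 `Bound[Psi,alphaI,0−1,AroundEi,s]` over `ℚ` (verbatim `Data.psiAlphaI01`). [cite: FitznerVanDerHofstad2017, notebook Percolation.nb cell 37] -/
noncomputable def psiAlphaI01 (s : Pt) (y : StateQ) : ℚ :=
  E.ev P s y (PsiAlphaI01main P)
    + E.ev P s y (PsiAlphaI01coef P) * (1 - 2 * ((1 - E.ev P s y (PsiAlphaI01brA P)) * (1 - E.ev P s y (PsiAlphaI01brB P))))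

/-- cell 37 `Bound[Psi,alphaII,0−1,AroundZero,s]` over `ℚ` (verbatim `Data.psiAlphaII01`). [cite: FitznerVanDerHofstad2017, notebook Percolation.nb cell 37] -/
noncomputable def psiAlphaII01 (s : Pt) (y : StateQ) : ℚ :=
  E.ev P s y (PsiAlphaII01main P)
    + E.ev P s y (PsiAlphaII01coef P) * (1 - (1 - E.ev P s y (PsiAlphaII01brA P)) * (1 - E.ev P s y (PsiAlphaII01brB P)))

/-- cell 44 `mumin[s]` over `ℚ` (verbatim `Data.muMin`). [cite: FitznerVanDerHofstad2017, notebook Percolation.nb cell 44] -/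
noncomputable def muMin (s : Pt) (y : StateQ) : ℚ := zIrQ P * (1 - max (E.g13 P s y) (E.g13 P .i y))

/-- Cell 44 at rational data, AS A REAL RECORD whose sixty entries are casts of rationals (field ↦ cell exactly as
`Stage1Frame.Data.inp`, tail-free variant `T″₀`). [cite: FitznerVanDerHofstad2017, notebook Percolation.nb cell 44 (transcript l.1214–1237)] -/
noncomputable def inpR (y : StateQ) (s : Pt) : Inputs where
  mu := ((y.m : ℚ) : ℝ)
  muMin := ((E.muMin P s y : ℚ) : ℝ)
  mubOverMu := ((E.ev P s y mubOverMu : ℚ) : ℝ)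
  mub := ((E.ev P s y z : ℚ) : ℝ)
  xiAlphaOneMinusZeroAtZero := 0
  xiAlphaZeroMinusOneAtZero := 0
  xiAlphaOneMinusZeroAtEi := ((E.ev P s y (XiAlpha10 P) : ℚ) : ℝ)
  xiAlphaZeroMinusOneAtEi := ((E.ev P s y (XiAlpha01 P) : ℚ) : ℝ)
  xiIotaAlphaIAtEi := ((E.ev P s y (XiIotaAlphaI0 P) : ℚ) : ℝ)
  xiIotaAlphaIIAtZero := ((E.ev P s y XiIotaAlphaII0 : ℚ) : ℝ)
  xiIotaAlphaISumAroundEi := ((E.ev P s y (XiIotaAlphaISum P) : ℚ) : ℝ)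
  xiIotaAlphaIISumAroundZero := ((E.ev P s y (XiIotaAlphaIISum P) : ℚ) : ℝ)
  psiAlphaIOneMinusZeroAroundEi := ((E.ev P s y (PsiAlphaI10 P) : ℚ) : ℝ)
  psiAlphaIIZeroMinusOneAroundZero := ((E.psiAlphaII01 P s y : ℚ) : ℝ)
  psiAlphaIZeroMinusOneAroundEi := ((E.psiAlphaI01 P s y : ℚ) : ℝ)
  psiAlphaIIOneMinusZeroAroundZero := ((E.ev P s y (PsiAlphaII10 P) : ℚ) : ℝ)
  piAlpha := ((E.ev P s y (PiAlpha0 P) : ℚ) : ℝ)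
  piAlphaLower := ((E.piAlphaLower0 P s y : ℚ) : ℝ)
  piOneLower := ((E.pi1Lower P s y : ℚ) : ℝ)
  psiZeroLower := ((E.psiLower0 P s y : ℚ) : ℝ)
  xiAbs := ((E.ev P s y (XiAbs P) : ℚ) : ℝ)
  xiOdd := ((E.ev P s y (XiOdd P) : ℚ) : ℝ)
  xiEven := ((E.ev P s y (XiEven P) : ℚ) : ℝ)
  xiEvenTail := ((E.ev P s y (Xi2 P) : ℚ) : ℝ)
  xiOddTail := ((E.ev P s y (Xi3 P) : ℚ) : ℝ)
  xiR0 := ((E.ev P s y (XiR0 P) : ℚ) : ℝ)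
  xiR1 := ((E.ev P s y (XiR1 P) : ℚ) : ℝ)
  xiR0Delta := ((E.ev P s y (XiR0D P) : ℚ) : ℝ)
  xiR1Delta := ((E.ev P s y (XiR1D P) : ℚ) : ℝ)
  xiDeltaAbs := ((E.ev P s y (XiAbsD P) : ℚ) : ℝ)
  xiOddDelta := ((E.ev P s y (XiOddD P) : ℚ) : ℝ)
  xiEvenDelta := ((E.ev P s y (XiEvenD P) : ℚ) : ℝ)
  xiOddTailDelta := ((E.ev P s y (Xi3D P) : ℚ) : ℝ)
  xiEvenTailDelta := ((E.ev P s y (Xi2D P) : ℚ) : ℝ)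
  psiRI0 := ((E.ev P s y (PsiRI0 P) : ℚ) : ℝ)
  psiRI1 := ((E.ev P s y (PsiRI1 P) : ℚ) : ℝ)
  psiRII0 := ((E.ev P s y (PsiRII0 P) : ℚ) : ℝ)
  psiRII1 := ((E.ev P s y (PsiRII1 P) : ℚ) : ℝ)
  psiRI0Delta := ((E.ev P s y (PsiRI0D P) : ℚ) : ℝ)
  psiRI1Delta := ((E.ev P s y (PsiRI1D P) : ℚ) : ℝ)
  psiRII0Delta := ((E.ev P s y (PsiRII0D P) : ℚ) : ℝ)
  psiRII1Delta := ((E.ev P s y (PsiRII1D P) : ℚ) : ℝ)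
  piR0 := ((E.ev P s y (PiR0 P) : ℚ) : ℝ)
  piR0DeltaEiEk := ((E.ev P s y (PiR0D P) : ℚ) : ℝ)
  xiIotaAbs := ((E.ev P s y (XiIotaAbs P) : ℚ) : ℝ)
  xiIotaOdd := ((E.ev P s y (XiIotaOdd P) : ℚ) : ℝ)
  xiIotaEven := ((E.ev P s y (XiIotaEven P) : ℚ) : ℝ)
  xiIotaEvenTail := ((E.ev P s y (XiIota2 P) : ℚ) : ℝ)
  xiIotaRI0 := ((E.ev P s y (XiIotaRI0 P) : ℚ) : ℝ)
  xiIotaRII0 := ((E.ev P s y (XiIotaRII0 P) : ℚ) : ℝ)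
  xiIotaDeltaEi := ((E.ev P s y (XiIotaAbsDei P) : ℚ) : ℝ)
  xiIotaOddDeltaEi := ((E.ev P s y (XiIotaOddDei P) : ℚ) : ℝ)
  xiIotaEvenDeltaEi := ((E.ev P s y (XiIotaEvenDei P) : ℚ) : ℝ)
  xiIotaEvenTailDeltaEi := ((E.ev P s y (XiIota2Dei P) : ℚ) : ℝ)
  xiIotaDeltaZero := ((E.ev P s y (XiIotaAbsD0 P) : ℚ) : ℝ)
  xiIotaOddDeltaZero := ((E.ev P s y (XiIotaOddD0 P) : ℚ) : ℝ)
  xiIotaEvenDeltaZero := ((E.ev P s y (XiIotaEvenD0 P) : ℚ) : ℝ)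
  xiIotaEvenTailDeltaZero := ((E.ev P s y (XiIota2D0 P) : ℚ) : ℝ)
  xiIotaRI0DeltaEi := ((E.ev P s y (XiIotaRI0Dei P) : ℚ) : ℝ)
  xiIotaRII0DeltaZero := ((E.ev P s y (XiIotaRII0D0 P) : ℚ) : ℝ)

end DataQ

/-! ## The model relation and the cast lemmas -/

namespace Data

variable {ν : Type*}

/-- `D` IS MODELLED BY the rational data `E`: its stage-1 tables are the casts of `E.tabs` and its six initial-point
cells `boundF3[j,i]` are the casts of `E.ic`. [folklore] -/
structure RatModel (D : Data ν) (E : DataQ) : Prop where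
  /-- the tables are rational -/
  tabs : D.tabs = E.tabs.cast
  /-- the initial cells are rational -/
  initCell : D.initCell = fun j => ((E.ic j : ℚ) : ℝ)

variable {D : Data ν} {E : DataQ} (h : D.RatModel E)
include h

/-- the basic valuation at a rational state is the cast of the rational one. [folklore] -/
theorem val0_ratCast (s : Pt) (y : StateQ) : D.val0 s y.cast = fun a => ((E.val0 D.P s y a : ℚ) : ℝ) := by
  funext a
  cases a <;> cases s <;>
    simp only [Data.val0, DataQ.val0, Data.zAt, Data.VAt, Data.cAt, zAtQ, VAtQ, DataQ.cAt, Data.dR, dQ,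
      StateQ.cast_Gamma1, StateQ.cast_Gamma2, StateQ.cast_c, h.initCell] <;> push_cast <;> rfl

/-- the table valuation is the cast of the rational one. [folklore] -/
theorem tabsVal_ratCast : D.tabs.val D.P.d = fun k => ((E.tabs.val D.P.d k : ℚ) : ℝ) := by
  rw [h.tabs]; exact E.tabs.val_cast' D.P.d

/-- `ev0` at a rational state is the cast of the rational `ev0`. [folklore] -/
theorem ev0_ratCast (s : Pt) (y : StateQ) (e : T) : D.ev0 s y.cast e = ((E.ev0 D.P s y e : ℚ) : ℝ) := by
  rw [Data.ev0, DataQ.ev0, val0_ratCast h, tabsVal_ratCast h]; exact eval_ratCast _ _ e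

/-- `Bound[G,{1},3,s]` is the cast of the rational one. [folklore] -/
theorem g13_ratCast (s : Pt) (y : StateQ) : D.g13 s y.cast = ((E.g13 D.P s y : ℚ) : ℝ) := ev0_ratCast h s y _

/-- `Bound[OpenBubble,1,s]` is the cast of the rational one. [folklore] -/
theorem ob1_ratCast (s : Pt) (y : StateQ) : D.ob1 s y.cast = ((E.ob1 D.P s y : ℚ) : ℝ) := ev0_ratCast h s y _

/-- the full valuation at a rational state is the cast of the rational one. [folklore] -/
theorem val_ratCast (s : Pt) (y : StateQ) : D.val s y.cast = fun a => ((E.val D.P s y a : ℚ) : ℝ) := by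
  funext a
  cases a with
  | G13at t => simp only [val_G13at, g13_ratCast h, DataQ.val]
  | mubOverMu => simp only [val_mubOverMu, g13_ratCast h, DataQ.val]; push_cast; all_goals rfl
  | mubOverMuI => simp only [val_mubOverMuI, g13_ratCast h, DataQ.val]; push_cast; all_goals rfl
  | hdInv => simp only [val_hdInv, ob1_ratCast h, DataQ.val]; push_cast; all_goals rfl
  | z => exact congrFun (val0_ratCast h s y) .z
  | V => exact congrFun (val0_ratCast h s y) .V
  | cw j => exact congrFun (val0_ratCast h s y) (.cw j)
  | Vo => exact congrFun (val0_ratCast h s y) .Vo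

/-- THE CAST LEMMA FOR CELLS: a typed cell at rational data has the cast of its rational value. [folklore] -/
theorem ev_ratCast (s : Pt) (y : StateQ) (e : T) : D.ev s y.cast e = ((E.ev D.P s y e : ℚ) : ℝ) := by
  rw [Data.ev, DataQ.ev, val_ratCast h, tabsVal_ratCast h]; exact eval_ratCast _ _ e

omit h in
/-- `z[i]` is rational. [folklore] -/
theorem zIr_ratCast : D.zIr = ((zIrQ D.P : ℚ) : ℝ) := by simp only [Data.zIr, zIrQ, Data.dR, dQ]; push_cast; all_goals rfl
omit h in
/-- `K₁` is rational. [folklore] -/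
theorem K1_ratCast : D.K1 = ((K1Q D.P : ℚ) : ℝ) := by simp only [Data.K1, K1Q, Data.zIr, zIrQ, Data.dR, dQ]; push_cast; all_goals rfl
omit h in
/-- `K₂` is rational. [folklore] -/
theorem K2_ratCast : D.K2 = ((K2Q D.P : ℚ) : ℝ) := by simp only [Data.K2, K2Q, Data.zIr, zIrQ, Data.dR, dQ]; push_cast; all_goals rfl
omit h in
/-- `K₃` is rational. [folklore] -/
theorem K3_ratCast : D.K3 = ((K3Q D.P : ℚ) : ℝ) := by simp only [Data.K3, K3Q, Data.zIr, zIrQ, Data.dR, dQ]; push_cast; all_goals rfl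
omit h in
/-- `K₄` is rational. [folklore] -/
theorem K4_ratCast : D.K4 = ((K4Q D.P : ℚ) : ℝ) := by simp only [Data.K4, K4Q, Data.zIr, zIrQ, Data.dR, dQ]; push_cast; all_goals rfl
omit h in
/-- `K₅` is rational. [folklore] -/
theorem K5_ratCast : D.K5 = ((K5Q D.P : ℚ) : ℝ) := by simp only [Data.K5, K5Q, Data.zIr, zIrQ, Data.dR, dQ]; push_cast; all_goals rfl

/-- cell 36 `Bound[Pi,alpha,lower,0,s]` is the cast of the rational one. [folklore] -/
theorem piAlphaLower0_ratCast (s : Pt) (y : StateQ) :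
    D.piAlphaLower0 s y.cast = ((E.piAlphaLower0 D.P s y : ℚ) : ℝ) := by
  simp only [Data.piAlphaLower0, DataQ.piAlphaLower0, ev_ratCast h, K1_ratCast, K2_ratCast]; push_cast; all_goals rfl

/-- cell 36 `Bound[Psi,lower,0,s]` is the cast of the rational one. [folklore] -/
theorem psiLower0_ratCast (s : Pt) (y : StateQ) : D.psiLower0 s y.cast = ((E.psiLower0 D.P s y : ℚ) : ℝ) := by
  simp only [Data.psiLower0, DataQ.psiLower0, ev_ratCast h, K1_ratCast, K3_ratCast, Data.zIr, zIrQ, Data.dR, dQ]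
  push_cast; all_goals rfl

/-- cell 36 `Bound[Pi,1,Lower,s]` is the cast of the rational one. [folklore] -/
theorem pi1Lower_ratCast (s : Pt) (y : StateQ) : D.pi1Lower s y.cast = ((E.pi1Lower D.P s y : ℚ) : ℝ) := by
  simp only [Data.pi1Lower, DataQ.pi1Lower, ev_ratCast h, K4_ratCast, K5_ratCast, Data.zIr, zIrQ, Data.dR, dQ]
  push_cast; all_goals rfl

/-- cell 37 `Bound[Psi,alphaI,0−1,AroundEi,s]` is the cast of the rational one. [folklore] -/
theorem psiAlphaI01_ratCast (s : Pt) (y : StateQ) :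
    D.psiAlphaI01 s y.cast = ((E.psiAlphaI01 D.P s y : ℚ) : ℝ) := by
  simp only [Data.psiAlphaI01, DataQ.psiAlphaI01, ev_ratCast h]; push_cast; all_goals rfl

/-- cell 37 `Bound[Psi,alphaII,0−1,AroundZero,s]` is the cast of the rational one. [folklore] -/
theorem psiAlphaII01_ratCast (s : Pt) (y : StateQ) :
    D.psiAlphaII01 s y.cast = ((E.psiAlphaII01 D.P s y : ℚ) : ℝ) := by
  simp only [Data.psiAlphaII01, DataQ.psiAlphaII01, ev_ratCast h]; push_cast; all_goals rfl

/-- cell 44 `mumin[s]` is the cast of the rational one. [folklore] -/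
theorem muMin_ratCast (s : Pt) (y : StateQ) : D.muMin s y.cast = ((E.muMin D.P s y : ℚ) : ℝ) := by
  simp only [Data.muMin, DataQ.muMin, g13_ratCast h, zIr_ratCast]; push_cast; all_goals rfl

/-- CELL 44 AT RATIONAL DATA: the typed App. D input record at a rational state is, field by field, the cast of its
rational value. [folklore] -/
theorem inp_ratCast (y : StateQ) (s : Pt) : D.inp y.cast s = E.inpR D.P y s := by
  simp only [Data.inp, DataQ.inpR, ev_ratCast h, muMin_ratCast h, piAlphaLower0_ratCast h, psiLower0_ratCast h,
    pi1Lower_ratCast h, psiAlphaI01_ratCast h, psiAlphaII01_ratCast h, StateQ.cast_m]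

/-- KERNEL FORM OF AN UPPER COMPARISON: the typed record is dominated by `N` as soon as the rational record is — sixty
inequalities `↑q ≤ numeral` / `numeral ≤ ↑q`, each `norm_cast; decide +kernel`. [folklore] -/
theorem inp_dom_of_ratModel {y : StateQ} {s : Pt} {N : Inputs} (hN : (E.inpR D.P y s).Dom N) :
    (D.inp y.cast s).Dom N := by
  rw [inp_ratCast h]; exact hN

/-- kernel form of a lower comparison (`N` dominated by the typed record). [folklore] -/
theorem dom_inp_of_ratModel {y : StateQ} {s : Pt} {N : Inputs} (hN : N.Dom (E.inpR D.P y s)) :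
    N.Dom (D.inp y.cast s) := by
  rw [inp_ratCast h]; exact hN

/-- KERNEL FORM OF THE VALIDITY CONDITIONS `Data.UAt` at a rational state: seven decidable rational inequalities.
[folklore] -/
theorem uAt_of_ratModel {y : StateQ} {s : Pt} (hg : E.g13 D.P s y < 1) (hob : E.ob1 D.P s y < 1)
    (h3a : E.ev D.P s y (pi1Br3a D.P) ≤ 1) (h5a : E.ev D.P s y (pi1Br5a D.P) ≤ 1)
    (h5b : E.ev D.P s y (pi1Br5b D.P) ≤ 1) (hA : E.ev D.P s y (PsiAlphaII01brA D.P) ≤ 1)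
    (hB : E.ev D.P s y (PsiAlphaII01brB D.P) ≤ 1) : D.UAt s y.cast where
  g13 := by rw [g13_ratCast h]; exact_mod_cast hg
  ob1 := by rw [ob1_ratCast h]; exact_mod_cast hob
  br3a := by rw [ev_ratCast h]; exact_mod_cast h3a
  br5a := by rw [ev_ratCast h]; exact_mod_cast h5a
  br5b := by rw [ev_ratCast h]; exact_mod_cast h5b
  brIIA := by rw [ev_ratCast h]; exact_mod_cast hA
  brIIB := by rw [ev_ratCast h]; exact_mod_cast hB

/-- every cell is `≥ 0` at a rational state as soon as its rational value is (the hypothesis `hev` of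
`Stage1Tails.inp_dom_inpFull`, field by field). [folklore] -/
theorem ev_nonneg_of_ratModel {y : StateQ} {s : Pt} {e : T} (he : 0 ≤ E.ev D.P s y e) : 0 ≤ D.ev s y.cast e := by
  rw [ev_ratCast h]; exact_mod_cast he

end Data

end Stage1Cells
end Literature.Probability.FitznerVanDerHofstad2017
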